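import Literature.NumberTheory.Automorphic.PairLFunctionNeConjGlobalRankinSelberg
import Literature.NumberTheory.Automorphic.PairLFunctionNeConjGlobalRankinSelbergTwisted
import Literature.NumberTheory.Automorphic.RankinSelbergUnfoldedEulerCuspidalPairsTranslate
import HarnessLib

/-!
# The global Rankin–Selberg theorems for a pair of cusp forms with Tate's character of ARBITRARY local
conductor off `S'` (the places dividing the different allowed outside `S'`)

Topic `NumberTheory/Automorphic`; namespace `Literature.NumberTheory.Automorphic`. Proof file (theorems
only). `exists_entire_eq_mul_partialPairL_mul_setIntegral_pair` (`PairLFunctionNeConjGlobalRankinSelberg`,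
pairs with a common central action) and `exists_entire_eq_partialPairL_mul_setIntegral_pair_twisted`
(`PairLFunctionNeConjGlobalRankinSelbergTwisted`, pairs with `ω_π ω̄_σ ≠ 1`) produce, for the global
Rankin–Selberg integral of smoothed cusp forms, an entire function equal on the strip `1 < re s < 2` to
`(s (s - 1)) · C · L^{S'}(s, π × π̄') · Ψ_{S'}(s)`, under the hypothesis that off `S'` both `v ∤ 𝔫₀` and
`v ∤ 𝔡_{K/ℚ}` (Tate's character `ψ_K` has conductor `𝒪_v` exactly off the different). Here the second
condition is removed: given a torus element `τ ∈ (𝔸_Kˣ)ⁿ` with last entry `1` whose `v`-component, for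
each `v ∉ S'`, is `diag(d)` with constant ratios `a_v` such that `ψ_{K,v}(a_v ·)` has conductor `𝒪_v`
(the Whittaker shifts at `v ∣ 𝔡`, `1` elsewhere), the same entire functions equal on the strip
`(s (s - 1)) · C · w_s(τ) · L^{S'}(s, π × π̄') · Ψ^τ_{S'}(s)` with the TRANSLATED `S'`-part
`Ψ^τ_{S'}(s) = ∫_{B({v ∉ S'}) × K} W_φ(diag τ ·) W̄_{φ'}(diag τ ·) Φ(e_n ·) |det|^s δ_B⁻¹` and the entire
nowhere-zero weight `w_s(τ) = |det τ|^s δ_B(τ)⁻¹`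
(`exists_entire_eq_mul_partialPairL_mul_setIntegral_pair_translate`,
`exists_entire_eq_partialPairL_mul_setIntegral_pair_twisted_translate`): the proofs are those of the two
source theorems with the Euler factorisation `rankinSelbergTorusPairIntegralC_whittakerCoeff_eq_partialPairL_mul`
replaced by its translated form (`RankinSelbergUnfoldedEulerCuspidalPairsTranslate`). Cogdell (2004),
Thm. 2.1–2.2, §3.1 (unnormalised `ψ_v`: "translate the essential vector"), §4.2; Jacquet–Shalika (1981), §4.

## References

* C. Mœglin, J.-L. Waldspurger, *Le spectre résiduel de GL(n)*, Ann. Sci. ÉNS 22 (1989), Appendice,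
  Corollaire (i)(b), p. 667 [MoeglinWaldspurger1989].
* J. W. Cogdell, *Analytic theory of L-functions for GL_n* (2004), §2.3 Thm. 2.1–2.2, §3.1, §4.2
  [CogdellAnalyticTheory2004].
* H. Jacquet, J. A. Shalika, Amer. J. Math. 103 (1981), I §4 [JacquetShalikaAJM1981].
-/

noncomputable section

open MeasureTheory Measure NumberField IsDedekindDomain Matrix Set Filter Topology
open scoped ENNReal NNReal ComplexConjugate

namespace Literature.NumberTheory.Automorphic

open Literature.NumberTheory.GaloisRepresentations (ideleGroup HeckeCharacter)

-- the automorphic quotient carries the tree's Borel σ-algebra, not Mathlib's quotient σ-algebra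
-- (verbatim from `RankinSelbergUnfoldingIdentity`)
attribute [-instance] Quotient.instMeasurableSpace QuotientGroup.measurableSpace

section PairGlobalTranslate

open ValuativeRel

variable {n : ℕ} {K : Type} [Field K] [NumberField K]
variable [MeasurableSpace (AdeleRing (𝓞 K) K)] [BorelSpace (AdeleRing (𝓞 K) K)]

-- the house local instances, exactly as in `RankinSelbergUnfoldingIdentity`
attribute [local instance] adelicBorel borelSpace_adelic locallyCompactSpace_adelic secondCountableTopology_gl_adelic
  glAdeleBorel borelSpace_glAdele borelSpace_ideleGroup secondCountableTopology_ideleGroup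

/-- **The global half of Corollaire (i)(b), common central action, Tate's character of any local
conductor off `S'`.** As `exists_entire_eq_mul_partialPairL_mul_setIntegral_pair`, with the hypothesis
`v ∤ 𝔡` off `S'` replaced by a torus element `τ` (last entry `1`) realising at every `v ∉ S'` a diagonal
shift `diag(d)` of constant ratio `a_v` for which `ψ_{K,v}(a_v ·)` has conductor `𝒪_v`; on the strip the
entire function is `s (s - 1) · C · w_s(τ) · L^{S'}(s, α ⊗ γ̄) · Ψ^τ_{S'}(s)` with the translated `S'`-part.
[cite: MoeglinWaldspurger1989, Appendice, Corollaire (i)(b)] [cite: CogdellAnalyticTheory2004, §2.3 Thm. 2.2, §3.1, §4.2] -/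
theorem exists_entire_eq_mul_partialPairL_mul_setIntegral_pair_translate (hn : 0 < n)
    (μ' : Measure (AdelicGroupData.gl n K).automorphicQuotient) [(AdelicGroupData.gl n K).IsAutomorphicMeasure μ']
    (νI : Measure (ideleGroup K)) [νI.IsHaarMeasure]
    (νA : Measure (Fin n → ideleGroup K)) [IsHaarMeasure νA]
    (νK : Measure ↥(maximalCompactAdelic n K)) [IsHaarMeasure νK]
    (ν₀ : Measure ↥(adelicUnipotent n K)) [IsHaarMeasure ν₀] :
    ∃ C : ℝ, 0 < C ∧
      ∀ (P Q : CuspidalAutomorphicRepGL n K μ') (f : P.1.toSubmodule) (f' : Q.1.toSubmodule),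
        (∀ z : ideleGroup K, ∃ c : ℂ, ‖c‖ = 1 ∧
          (AdelicGroupData.gl n K).rightRegular μ' (Matrix.GeneralLinearGroup.scalar (Fin n) z)
              (f : (AdelicGroupData.gl n K).L2 μ') = c • (f : (AdelicGroupData.gl n K).L2 μ') ∧
          (AdelicGroupData.gl n K).rightRegular μ' (Matrix.GeneralLinearGroup.scalar (Fin n) z)
              (f' : (AdelicGroupData.gl n K).L2 μ') = c • (f' : (AdelicGroupData.gl n K).L2 μ')) →
      ∀ {S : Set (HeightOneSpectrum (𝓞 K))} {α γ : SatakeFamily K}, IsSatakeFamilyOf P S α →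
        IsSatakeFamilyOf Q S γ →
      ∀ {𝔫₀ : Ideal (𝓞 K)}, 𝔫₀ ≠ 0 →
      ∀ {η : (AdelicGroupData.gl n K).Adelic → ℝ}, IsTestFunctionGL n K η →
        (∀ k : (AdelicGroupData.gl n K).Adelic, k ∈ principalCongruenceLevel n K 𝔫₀ →
          ∀ g : (AdelicGroupData.gl n K).Adelic, η (k * g) = η g) →
      ∀ {S' : Set (HeightOneSpectrum (𝓞 K))}, S ⊆ S' → (∀ v ∉ S', ¬ v.asIdeal ∣ 𝔫₀) →
      ∀ (τ : Fin n → ideleGroup K), lastEntry τ = 1 →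
        (∀ v ∉ S', ∃ (d : Fin n → (v.adicCompletion K)ˣ) (a : (v.adicCompletion K)ˣ),
          localComponent v (glDiagonal n (AdeleRing (𝓞 K) K) τ) = diagonalGL (Fin n) (v.adicCompletion K) d ∧
          (∀ i j : Fin n, (i : ℕ) + 1 = j →
            (d i : v.adicCompletion K) * ((d j)⁻¹ : (v.adicCompletion K)ˣ) = a) ∧
          (∀ c ∈ 𝒪[v.adicCompletion K], (adeleAddChar K).adicComponent v (a * c) = 1) ∧
          ∀ ϖ : v.adicCompletion K, Valued.v ϖ = WithZero.exp (-1 : ℤ) →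
            ∃ c ∈ 𝒪[v.adicCompletion K], (adeleAddChar K).adicComponent v (a * (ϖ⁻¹ * c)) ≠ 1) →
      ∀ {x y : HeightOneSpectrum (𝓞 K) → Fin n → ℂ},
        (∀ v ∉ S', (Finset.univ : Finset (Fin n)).val.map (x v) = α v) →
        (∀ v ∉ S', (Finset.univ : Finset (Fin n)).val.map (y v) = γ v) →
      ∀ {Φinf : (Fin n → InfiniteAdeleRing K) → ℝ}, Continuous Φinf → (∀ z, 0 ≤ Φinf z) →
        (fun v => ((standardTestFun n K Φinf v : ℝ) : ℂ)) ∈ piSchwartzBruhat K (Fin n) →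
      ∃ F : ℂ → ℂ, Differentiable ℂ F ∧
        (∀ s : ℂ, 1 < s.re → F s = s * (s - 1) *
          rankinSelbergIntegral μ' νI (fun v => ((standardTestFun n K Φinf v : ℝ) : ℂ)) s
            (star (smoothedForm η (f' : (AdelicGroupData.gl n K).L2 μ')))
            (smoothedForm η (f : (AdelicGroupData.gl n K).L2 μ'))) ∧
        (∀ s : ℂ, 1 < s.re → s.re < 2 → F s = s * (s - 1) * ((C : ℂ) * (torusWeightC n K s τ *
          (partialPairL S' α (fun v => (γ v).map conj) s *
            ∫ p in unitBox {v | v ∉ S'} ×ˢ Set.univ, torusPairIntegrandC n K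
              (fun g => whittakerCoeff ν₀ (unipotentTateDomain n K) (adeleAddChar K)
                (invQuot (AdelicGroupData.gl n K) (smoothedForm η (f : (AdelicGroupData.gl n K).L2 μ')))
                (glDiagonal n (AdeleRing (𝓞 K) K) τ * g))
              (fun g => (star (whittakerCoeff ν₀ (unipotentTateDomain n K) (adeleAddChar K)
                (invQuot (AdelicGroupData.gl n K) (smoothedForm η (f' : (AdelicGroupData.gl n K).L2 μ')))))
                (glDiagonal n (AdeleRing (𝓞 K) K) τ * g))
              (standardTestFun n K Φinf) s p ∂(νA.prod νK))))) ∧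
        (multiplicity_one_gl n K μ' → P ≠ Q → F 1 = 0) := by
  classical
  haveI : T2Space (GL (Fin n) (AdeleRing (𝓞 K) K)) := t2Space_gl n K
  haveI : LocallyCompactSpace (GL (Fin n) (AdeleRing (𝓞 K) K)) :=
    AdelicGroupData.locallyCompactSpace_generalLinearGroup_adeleRing K (Fin n)
  haveI : SecondCountableTopology (GL (Fin n) (AdeleRing (𝓞 K) K)) :=
    secondCountableTopology_generalLinearGroup_adeleRing K (Fin n)
  haveI hν₀R : ν₀.IsMulRightInvariant := isMulRightInvariant_of_isHaarMeasure_adelicUnipotent ν₀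
  haveI := locallyCompactSpace_ideleGroup K
  haveI : CompactSpace ↥(maximalCompactAdelic n K) :=
    isCompact_iff_compactSpace.1 (isCompact_maximalCompactAdelic n K)
  obtain ⟨C, hC, hunf⟩ :=
    exists_rankinSelbergIntegral_star_eq_mul_rankinSelbergTorusPairIntegralC (n := n) (K := K) hn μ' νI νA νK ν₀
  refine ⟨C, hC, fun P Q f f' hZ {S} {α} {γ} hα hγ {𝔫₀} h𝔫₀ {η} hη hηK {S'} hSS' hS' τ hτ hτψ {x} {y} hx hy {Φinf}
    hΦic hΦi0 hΦS => ?_⟩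
  -- the test function
  set Φ : (Fin n → AdeleRing (𝓞 K) K) → ℝ := standardTestFun n K Φinf with hΦdef
  have hΦ0 : ∀ v, 0 ≤ Φ v := standardTestFun_nonneg hΦi0
  have hΦc : Continuous Φ := continuous_standardTestFun_of_continuous n K hΦic
  have hΦm : Measurable fun g : GL (Fin n) (AdeleRing (𝓞 K) K) => Φ (lastRow n K g) :=
    (hΦc.comp continuous_lastRow).measurable
  -- the entire continuation and the residue at `s = 1`
  obtain ⟨F, hF, hFI, hF1⟩ := exists_entire_eq_mul_rankinSelbergIntegral_star_of_ne hn μ' νI P Q f f' hη hΦS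
  refine ⟨F, hF, hFI, fun s hs1 hs2 => ?_, hF1⟩
  -- Tate's character and fundamental domain
  have hψ : IsGlobalAddChar K (adeleAddChar K) := isGlobalAddChar_adeleAddChar (K := K)
  have h𝓕 : IsFundamentalDomain ↥(rationalUnipotent n K) (unipotentTateDomain n K) ν₀ :=
    isFundamentalDomain_unipotentTateDomain ν₀
  have h𝓕c : IsCompact (closure (unipotentTateDomain n K)) := isCompact_closure_unipotentTateDomain
  have h𝓕m : MeasurableSet (unipotentTateDomain n K) := measurableSet_unipotentTateDomain
  -- finiteness of the two real unfolded integrals at `re s`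
  have hfin : rankinSelbergTorusIntegral n K νA νK
      (whittakerCoeff ν₀ (unipotentTateDomain n K) (adeleAddChar K)
        (invQuot (AdelicGroupData.gl n K) (smoothedForm η (f : (AdelicGroupData.gl n K).L2 μ')))) Φ s.re ≠ ⊤ :=
    rankinSelbergTorusIntegral_whittakerCoeff_ne_top_of_mem_piSchwartzBruhat hn νA νK ν₀ P f hη hΦS hΦ0 hΦm hs1
  have hfin' : rankinSelbergTorusIntegral n K νA νK
      (whittakerCoeff ν₀ (unipotentTateDomain n K) (adeleAddChar K)
        (invQuot (AdelicGroupData.gl n K) (smoothedForm η (f' : (AdelicGroupData.gl n K).L2 μ')))) Φ s.re ≠ ⊤ :=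
    rankinSelbergTorusIntegral_whittakerCoeff_ne_top_of_mem_piSchwartzBruhat hn νA νK ν₀ Q f' hη hΦS hΦ0 hΦm hs1
  -- unfold on the strip and factor, translating by `τ`
  rw [hFI s hs1, hunf P Q f f' hZ hη hΦS hΦ0 hΦm hs1 hs2,
    rankinSelbergTorusPairIntegralC_whittakerCoeff_eq_partialPairL_mul_translate hn P Q hα hγ h𝔫₀ hη.continuous
      hη.hasCompactSupport hηK f f' h𝓕 h𝓕m h𝓕c hψ hSS' hS' τ hτ hτψ hx hy hΦi0 hΦm νA νK hs1 hfin hfin']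

/-- **The global half of Corollaire (i)(b), `ω_π ω̄_σ ≠ 1`, Tate's character of any local conductor off
`S'`.** As `exists_entire_eq_partialPairL_mul_setIntegral_pair_twisted`, with the hypothesis `v ∤ 𝔡` off
`S'` replaced by a torus element `τ` (last entry `1`) realising at every `v ∉ S'` a diagonal shift of
constant ratio `a_v` for which `ψ_{K,v}(a_v ·)` has conductor `𝒪_v`; on the strip the entire function is
`C · w_s(τ) · L^{S'}(s, α ⊗ γ̄) · Ψ^τ_{S'}(s)` with the translated `S'`-part.
[cite: MoeglinWaldspurger1989, Appendice, Corollaire (i)(b)] [cite: CogdellAnalyticTheory2004, §2.3 Thm. 2.2, p. 211, §3.1] -/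
theorem exists_entire_eq_partialPairL_mul_setIntegral_pair_twisted_translate (hn : 0 < n)
    (μ' : Measure (AdelicGroupData.gl n K).automorphicQuotient) [(AdelicGroupData.gl n K).IsAutomorphicMeasure μ']
    (νI : Measure (ideleGroup K)) [νI.IsHaarMeasure]
    (νA : Measure (Fin n → ideleGroup K)) [IsHaarMeasure νA]
    (νK : Measure ↥(maximalCompactAdelic n K)) [IsHaarMeasure νK]
    (ν₀ : Measure ↥(adelicUnipotent n K)) [IsHaarMeasure ν₀] :
    ∃ C : ℝ, 0 < C ∧
      ∀ (P Q : CuspidalAutomorphicRepGL n K μ') (f : P.1.toSubmodule) (f' : Q.1.toSubmodule)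
        {ω ω' η : HeckeCharacter K}, ω.IsUnitary → ω'.IsUnitary → η = ω * ω'⁻¹ → η ≠ 1 →
      ∀ (hη₀ : ∀ t : ℝ≥0ˣ, η (posRealIdele K t) = 1)
        {S : Set (HeightOneSpectrum (𝓞 K))} {α γ : SatakeFamily K}, IsSatakeFamilyOf P S α →
        IsSatakeFamilyOf Q S γ →
      ∀ {𝔫₀ : Ideal (𝓞 K)}, 𝔫₀ ≠ 0 →
      ∀ {θ : (AdelicGroupData.gl n K).Adelic → ℝ}, IsTestFunctionGL n K θ →
        (∀ k : (AdelicGroupData.gl n K).Adelic, k ∈ principalCongruenceLevel n K 𝔫₀ →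
          ∀ g : (AdelicGroupData.gl n K).Adelic, θ (k * g) = θ g) →
        (∀ (z : ideleGroup K) (g : GL (Fin n) (AdeleRing (𝓞 K) K)),
          smoothedForm θ (f : (AdelicGroupData.gl n K).L2 μ')
              ((AdelicGroupData.gl n K).toAutomorphicQuotient (Matrix.GeneralLinearGroup.scalar (Fin n) z * g)) =
            ((ω z : ℂˣ) : ℂ)⁻¹ * smoothedForm θ (f : (AdelicGroupData.gl n K).L2 μ')
              ((AdelicGroupData.gl n K).toAutomorphicQuotient g)) →
        (∀ (z : ideleGroup K) (g : GL (Fin n) (AdeleRing (𝓞 K) K)),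
          smoothedForm θ (f' : (AdelicGroupData.gl n K).L2 μ')
              ((AdelicGroupData.gl n K).toAutomorphicQuotient (Matrix.GeneralLinearGroup.scalar (Fin n) z * g)) =
            ((ω' z : ℂˣ) : ℂ)⁻¹ * smoothedForm θ (f' : (AdelicGroupData.gl n K).L2 μ')
              ((AdelicGroupData.gl n K).toAutomorphicQuotient g)) →
      ∀ {S' : Set (HeightOneSpectrum (𝓞 K))}, S ⊆ S' → (∀ v ∉ S', ¬ v.asIdeal ∣ 𝔫₀) →
      ∀ (τ : Fin n → ideleGroup K), lastEntry τ = 1 →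
        (∀ v ∉ S', ∃ (d : Fin n → (v.adicCompletion K)ˣ) (a : (v.adicCompletion K)ˣ),
          localComponent v (glDiagonal n (AdeleRing (𝓞 K) K) τ) = diagonalGL (Fin n) (v.adicCompletion K) d ∧
          (∀ i j : Fin n, (i : ℕ) + 1 = j →
            (d i : v.adicCompletion K) * ((d j)⁻¹ : (v.adicCompletion K)ˣ) = a) ∧
          (∀ c ∈ 𝒪[v.adicCompletion K], (adeleAddChar K).adicComponent v (a * c) = 1) ∧
          ∀ ϖ : v.adicCompletion K, Valued.v ϖ = WithZero.exp (-1 : ℤ) →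
            ∃ c ∈ 𝒪[v.adicCompletion K], (adeleAddChar K).adicComponent v (a * (ϖ⁻¹ * c)) ≠ 1) →
      ∀ {x y : HeightOneSpectrum (𝓞 K) → Fin n → ℂ},
        (∀ v ∉ S', (Finset.univ : Finset (Fin n)).val.map (x v) = α v) →
        (∀ v ∉ S', (Finset.univ : Finset (Fin n)).val.map (y v) = γ v) →
      ∀ {Φinf : (Fin n → InfiniteAdeleRing K) → ℝ}, Continuous Φinf → (∀ z, 0 ≤ Φinf z) →
        (fun v => ((standardTestFun n K Φinf v : ℝ) : ℂ)) ∈ piSchwartzBruhat K (Fin n) →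
      ∃ F : ℂ → ℂ, Differentiable ℂ F ∧
        (∀ s : ℂ, 1 < s.re → F s =
          rankinSelbergIntegralTwisted μ' νI hη₀ (fun v => ((standardTestFun n K Φinf v : ℝ) : ℂ)) s
            (star (smoothedForm θ (f' : (AdelicGroupData.gl n K).L2 μ')))
            (smoothedForm θ (f : (AdelicGroupData.gl n K).L2 μ'))) ∧
        (∀ s : ℂ, 1 < s.re → s.re < 2 → F s = (C : ℂ) * (torusWeightC n K s τ *
          (partialPairL S' α (fun v => (γ v).map conj) s *
            ∫ p in unitBox {v | v ∉ S'} ×ˢ Set.univ, torusPairIntegrandC n K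
              (fun g => whittakerCoeff ν₀ (unipotentTateDomain n K) (adeleAddChar K)
                (invQuot (AdelicGroupData.gl n K) (smoothedForm θ (f : (AdelicGroupData.gl n K).L2 μ')))
                (glDiagonal n (AdeleRing (𝓞 K) K) τ * g))
              (fun g => (star (whittakerCoeff ν₀ (unipotentTateDomain n K) (adeleAddChar K)
                (invQuot (AdelicGroupData.gl n K) (smoothedForm θ (f' : (AdelicGroupData.gl n K).L2 μ')))))
                (glDiagonal n (AdeleRing (𝓞 K) K) τ * g))
              (standardTestFun n K Φinf) s p ∂(νA.prod νK)))) := by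
  classical
  haveI : T2Space (GL (Fin n) (AdeleRing (𝓞 K) K)) := t2Space_gl n K
  haveI : LocallyCompactSpace (GL (Fin n) (AdeleRing (𝓞 K) K)) :=
    AdelicGroupData.locallyCompactSpace_generalLinearGroup_adeleRing K (Fin n)
  haveI : SecondCountableTopology (GL (Fin n) (AdeleRing (𝓞 K) K)) :=
    secondCountableTopology_generalLinearGroup_adeleRing K (Fin n)
  haveI hν₀R : ν₀.IsMulRightInvariant := isMulRightInvariant_of_isHaarMeasure_adelicUnipotent ν₀
  haveI hνIR : νI.IsMulRightInvariant := by
    haveI := isInvInvariant_of_isHaarMeasure_ideleGroup (K := K) νI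
    infer_instance
  haveI := locallyCompactSpace_ideleGroup K
  haveI : CompactSpace ↥(maximalCompactAdelic n K) :=
    isCompact_iff_compactSpace.1 (isCompact_maximalCompactAdelic n K)
  obtain ⟨C, hC, hunf⟩ :=
    exists_rankinSelbergIntegralTwisted_star_eq_mul_rankinSelbergTorusPairIntegralC (n := n) (K := K) hn μ' νI νA νK ν₀
  refine ⟨C, hC, fun P Q f f' {ω ω' η} hωu hω'u hηeq hη1 hη₀ {S} {α} {γ} hα hγ {𝔫₀} h𝔫₀ {θ} hθ hθK hωf hω'f'
    {S'} hSS' hS' τ hτ hτψ {x} {y} hx hy {Φinf} hΦic hΦi0 hΦS => ?_⟩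
  -- the test function
  set Φ : (Fin n → AdeleRing (𝓞 K) K) → ℝ := standardTestFun n K Φinf with hΦdef
  have hΦ0 : ∀ v, 0 ≤ Φ v := standardTestFun_nonneg hΦi0
  have hΦc : Continuous Φ := continuous_standardTestFun_of_continuous n K hΦic
  have hΦm : Measurable fun g : GL (Fin n) (AdeleRing (𝓞 K) K) => Φ (lastRow n K g) :=
    (hΦc.comp continuous_lastRow).measurable
  -- the twisting character is unitary and non-trivial on `𝕀_K¹`
  have hηu : η.IsUnitary := by
    intro a
    rw [hηeq, HeckeCharacter.mul_apply, HeckeCharacter.inv_apply, Units.val_mul, Units.val_inv_eq_inv_val,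
      norm_mul, norm_inv, hωu a, hω'u a, inv_one, mul_one]
  have hηb : ∃ b : ideleGroup K, IdeleClassGroup.ideleNorm K b = 1 ∧ η b ≠ 1 :=
    η.exists_ideleNorm_eq_one_and_ne_one_of_map_posRealIdele hη₀ hη1
  -- the entire continuation of `I_η`
  have hφtc : Continuous (smoothedForm θ (f : (AdelicGroupData.gl n K).L2 μ')) :=
    continuous_smoothedForm hθ.continuous hθ.hasCompactSupport _
  have hφt'c : Continuous (smoothedForm θ (f' : (AdelicGroupData.gl n K).L2 μ')) :=
    continuous_smoothedForm hθ.continuous hθ.hasCompactSupport _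
  have hφd : IsRapidlyDecreasingGL n K (invQuot (AdelicGroupData.gl n K) (smoothedForm θ (f : (AdelicGroupData.gl n K).L2 μ'))) :=
    isRapidlyDecreasingGL_invQuot_smoothedForm hθ (P.2.1 f.2)
  have hφ'd : IsRapidlyDecreasingGL n K (invQuot (AdelicGroupData.gl n K)
      (star (smoothedForm θ (f' : (AdelicGroupData.gl n K).L2 μ')))) :=
    isRapidlyDecreasingGL_invQuot_star (isRapidlyDecreasingGL_invQuot_smoothedForm hθ (Q.2.1 f'.2))
  obtain ⟨F, hF, hFI⟩ := exists_entire_eq_rankinSelbergIntegralTwisted (K := K) νI hn μ' hηu hηb hη₀ hΦS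
    (show Continuous (star (smoothedForm θ (f' : (AdelicGroupData.gl n K).L2 μ'))) from continuous_star.comp hφt'c)
    hφtc hφ'd hφd
  refine ⟨F, hF, hFI, fun s hs1 hs2 => ?_⟩
  -- Tate's character and fundamental domain
  have hψ : IsGlobalAddChar K (adeleAddChar K) := isGlobalAddChar_adeleAddChar (K := K)
  have h𝓕 : IsFundamentalDomain ↥(rationalUnipotent n K) (unipotentTateDomain n K) ν₀ :=
    isFundamentalDomain_unipotentTateDomain ν₀
  have h𝓕c : IsCompact (closure (unipotentTateDomain n K)) := isCompact_closure_unipotentTateDomain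
  have h𝓕m : MeasurableSet (unipotentTateDomain n K) := measurableSet_unipotentTateDomain
  -- finiteness of the two real unfolded integrals at `re s`
  have hfin : rankinSelbergTorusIntegral n K νA νK
      (whittakerCoeff ν₀ (unipotentTateDomain n K) (adeleAddChar K)
        (invQuot (AdelicGroupData.gl n K) (smoothedForm θ (f : (AdelicGroupData.gl n K).L2 μ')))) Φ s.re ≠ ⊤ :=
    rankinSelbergTorusIntegral_whittakerCoeff_ne_top_of_mem_piSchwartzBruhat hn νA νK ν₀ P f hθ hΦS hΦ0 hΦm hs1
  have hfin' : rankinSelbergTorusIntegral n K νA νK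
      (whittakerCoeff ν₀ (unipotentTateDomain n K) (adeleAddChar K)
        (invQuot (AdelicGroupData.gl n K) (smoothedForm θ (f' : (AdelicGroupData.gl n K).L2 μ')))) Φ s.re ≠ ⊤ :=
    rankinSelbergTorusIntegral_whittakerCoeff_ne_top_of_mem_piSchwartzBruhat hn νA νK ν₀ Q f' hθ hΦS hΦ0 hΦm hs1
  -- unfold on the strip and factor, translating by `τ`
  rw [hFI s hs1, hunf P Q f f' hωu hω'u hηeq hη1 hη₀ hθ hωf hω'f' hΦS hΦ0 hΦm hs1 hs2,
    rankinSelbergTorusPairIntegralC_whittakerCoeff_eq_partialPairL_mul_translate hn P Q hα hγ h𝔫₀ hθ.continuous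
      hθ.hasCompactSupport hθK f f' h𝓕 h𝓕m h𝓕c hψ hSS' hS' τ hτ hτψ hx hy hΦi0 hΦm νA νK hs1 hfin hfin']

end PairGlobalTranslate

end Literature.NumberTheory.Automorphic
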